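import Literature.Computability.Complexity.FoldBricks
import Literature.Computability.Complexity.StackBricksStrings
import Literature.Computability.Complexity.UnaryBricks
import Literature.Computability.MetaComplexity.UHSParameters
import HarnessLib

/-!
# The parameter word of the `2^{O(n / log n)}`-time algorithm (Hirahara's Cor. 6.4) is in `FP`

Topic `Literature/Computability/MetaComplexity`, machine layer (part 1) of the discharge of
`Hirahara2021_mem_DTIME_of_hasUHS` (`UniversalHeuristicSchemes.lean`; Hirahara, ECCC TR21-058,
Thm. 6.3 / Cor. 6.4). The algorithm is run as "pad, then a polynomial-time search": on input `x`
of length `n` a polynomial-time stage first writes the **parameter word**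

  `u(n) = ⟨1ᵏ, ⟨1ᴱ, 1ᴵ⟩⟩`  (`k, E, I` of `UHSParameters.lean`, `|u(n)| = UHSParam.m d a₀ n`)

next to `x`, the exponential pad `expPad 1` (`ExpPadding.lean`) then expands `u` to `1^{2^{|u|}} 0 u`,
and the search stage (`UHSSearch.lean`) reads `k`, `E`, `I` off `u`. This file builds the first
stage in the tree's algebra of `FP` string functions (no new machine, no loop):

* `UHSPad.IFn d x = 1ᴵ`, `UHSPad.kFn d a₀ x = 1ᵏ`, `UHSPad.powIFn d x = 1^{(2^d)^I}`,
  `UHSPad.EFn d x = 1ᴱ` (values `*_apply`, membership `*_mem_FP`), assembled from `Brick.logFn`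
  (`UnaryBricks.lean`), `Plumb.divModFn` / `Plumb.polyFn` (`PlumbingBricks.lean`),
  `binToUnaryFn` (`FPStringBricks.lean`: `2^{dI}` in unary is the numeral `⟦1^{dI}⟧ + 1` written
  out against the ruler `1^{2^d (n+1)}`, which is long enough by `UHSParam.pow_I_le`),
  `HashBricks.umulFn`;
* `UHSPad.uFn d a₀ x = u(|x|)` (`uFn_apply`, `length_uFn`, `uFn_mem_FP`) and the stage
  `UHSPad.FFn d a₀ x = ⟨u(|x|), x⟩` (`FFn_apply`, `FFn_mem_FP`).

## References

* S. Hirahara, *Average-case hardness of NP from exponential worst-case hardness assumptions*,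
  STOC 2021; full version ECCC TR21-058: proof of Thm. 6.3 (the parameters `I`, `k`), Cor. 6.4.
* S. Arora, B. Barak, *Computational Complexity: A Modern Approach*, CUP 2009, §1.3, §2.6.2
  (padding).
-/

namespace Literature.Computability.MetaComplexity

open _root_.Computability Complexity Complexity.Brick Complexity.Plumb Complexity.HashBricks Polynomial

namespace UHSPad

variable (d a₀ : ℕ)

/-! ### `I` -/

/-- `IFn d x = 1^{I d |x|}`: `1 · (⌊log₂ |x|⌋ / (2d))`, the quotient read off `Plumb.divModFn`.
[Hirahara 2021 (ECCC TR21-058), proof of Thm. 6.3 (`I := ε log n`)] [cite: Hirahara2021, Thm. 6.3 (proof)] -/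
noncomputable def IFn : List Bool → List Bool :=
  List.cons true ∘ fstF ∘ divModFn ∘ fanoutFn (fun _ => ones (2 * d)) logFn

/-- `1 1ᵃ = 1ᵃ⁺¹`. [folklore] -/
private theorem true_cons_ones (a : ℕ) : true :: ones a = ones (a + 1) := rfl

/-- Value of `IFn`. [folklore] -/
@[simp] theorem IFn_apply (x : List Bool) : IFn d x = ones (UHSParam.I d x.length) := by
  simp [IFn, logFn, UHSParam.I, true_cons_ones]

/-- `IFn d ∈ FP`. [folklore] -/
theorem IFn_mem_FP : IFn d ∈ FP :=
  comp_mem_FP (cons_mem_FP true) (comp_mem_FP fstF_mem_FP (comp_mem_FP divModFn_mem_FP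
    (fanoutFn_mem_FP (const_mem_FP _) logFn_mem_FP)))

/-! ### `k` -/

/-- `kFn d a₀ x = 1^{k d a₀ |x|}`: the quotient `(|x| + a₀) / I`. [Hirahara 2021 (ECCC TR21-058),
proof of Thm. 6.3 (`k := s(n)/I`)] [cite: Hirahara2021, Thm. 6.3 (proof)] -/
noncomputable def kFn : List Bool → List Bool :=
  fstF ∘ divModFn ∘ fanoutFn (IFn d) (polyFn (X + C a₀))

/-- Value of `kFn`. [folklore] -/
@[simp] theorem kFn_apply (x : List Bool) : kFn d a₀ x = ones (UHSParam.k d a₀ x.length) := by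
  simp [kFn, UHSParam.k]

/-- `kFn d a₀ ∈ FP`. [folklore] -/
theorem kFn_mem_FP : kFn d a₀ ∈ FP :=
  comp_mem_FP fstF_mem_FP (comp_mem_FP divModFn_mem_FP (fanoutFn_mem_FP (IFn_mem_FP d) (polyFn_mem_FP _)))

/-! ### `(2^d)^I` -/

/-- `powIFn d x = 1^{(2^d)^{I d |x|}}`: the numeral `⟦1^{d I}⟧ + 1 = 2^{d I}` written in unary
against the ruler `1^{2^d (|x| + 1)}` (`binToUnaryFn`), which is long enough
(`UHSParam.pow_I_le`: `(2^d)^I ≤ 2^d · 2^{⌊log₂ n⌋/2} ≤ 2^d (n + 1)`). [folklore] -/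
noncomputable def powIFn : List Bool → List Bool :=
  binToUnaryFn ∘ fanoutFn (polyFn (C (2 ^ d) * (X + 1)))
    (addFn ∘ fanoutFn (onesMulFn d ∘ IFn d) (fun _ => encodeNat 1))

/-- `(2^d)^{I d n} ≤ 2^d (n + 1)`. [folklore] -/
theorem pow_I_le_ruler (n : ℕ) : (2 ^ d) ^ UHSParam.I d n ≤ 2 ^ d * (n + 1) := by
  refine (UHSParam.pow_I_le d n).trans (Nat.mul_le_mul_left _ ?_)
  rcases Nat.eq_zero_or_pos n with rfl | hn
  · simp
  · calc 2 ^ (Nat.log 2 n / 2) ≤ 2 ^ Nat.log 2 n := Nat.pow_le_pow_right two_pos (Nat.div_le_self _ _)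
      _ ≤ n := Nat.pow_log_le_self 2 hn.ne'
      _ ≤ n + 1 := Nat.le_succ n

/-- Value of `powIFn`. [folklore] -/
@[simp] theorem powIFn_apply (x : List Bool) : powIFn d x = ones ((2 ^ d) ^ UHSParam.I d x.length) := by
  have hval : bitsToNat (onesMulFn d (List.replicate (UHSParam.I d x.length) true)) + 1 =
      (2 ^ d) ^ UHSParam.I d x.length := by
    rw [onesMulFn, List.length_replicate, ← ones, bitsToNat_ones, ← pow_mul]
    have := Nat.one_le_two_pow (n := d * UHSParam.I d x.length)
    omega
  simp only [powIFn, Function.comp_apply, fanoutFn_apply, polyFn_apply, IFn_apply, addFn_boolPair,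
    binToUnaryFn_boolPair, bitsToNat_encodeNat, eval_mul, eval_C, eval_add, eval_X, eval_one,
    ones, List.length_replicate, hval]
  rw [min_eq_left (pow_I_le_ruler d x.length)]

/-- `powIFn d ∈ FP`. [folklore] -/
theorem powIFn_mem_FP : powIFn d ∈ FP :=
  comp_mem_FP binToUnaryFn_mem_FP (fanoutFn_mem_FP (polyFn_mem_FP _)
    (comp_mem_FP addFn_mem_FP (fanoutFn_mem_FP (comp_mem_FP (onesMulFn_mem_FP d) (IFn_mem_FP d))
      (const_mem_FP _))))

/-! ### `E` -/

/-- `EFn d x = 1^{E d |x|}`: the product `(2^d)^I · (⌊log₂ (|x| + 2)⌋ + 1)` (`HashBricks.umulFn`).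
[Hirahara 2021 (ECCC TR21-058), proof of Thm. 6.3 (`p_i(n) ≤ n^{c^i}`)] [cite: Hirahara2021, Thm. 6.3 (proof)] -/
noncomputable def EFn : List Bool → List Bool :=
  umulFn ∘ fanoutFn (powIFn d) (polyFn (X + 1) ∘ logFn ∘ polyFn (X + 2))

/-- Value of `EFn`. [folklore] -/
@[simp] theorem EFn_apply (x : List Bool) : EFn d x = ones (UHSParam.E d x.length) := by
  simp [EFn, umulFn_apply, logFn, UHSParam.E]

/-- `EFn d ∈ FP`. [folklore] -/
theorem EFn_mem_FP : EFn d ∈ FP :=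
  comp_mem_FP umulFn_mem_FP (fanoutFn_mem_FP (powIFn_mem_FP d)
    (comp_mem_FP (polyFn_mem_FP _) (comp_mem_FP logFn_mem_FP (polyFn_mem_FP _))))

/-! ### The parameter word and the first stage -/

/-- The parameter word `u(n) = ⟨1ᵏ, ⟨1ᴱ, 1ᴵ⟩⟩` as a function of the input. [folklore] -/
noncomputable def uFn : List Bool → List Bool :=
  fanoutFn (kFn d a₀) (fanoutFn (EFn d) (IFn d))

/-- Value of `uFn`. [folklore] -/
theorem uFn_apply (x : List Bool) :
    uFn d a₀ x = boolPair (ones (UHSParam.k d a₀ x.length))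
      (boolPair (ones (UHSParam.E d x.length)) (ones (UHSParam.I d x.length))) := by
  simp [uFn]

/-- **`|u(n)| = UHSParam.m d a₀ n`.** [folklore] -/
theorem length_uFn (x : List Bool) : (uFn d a₀ x).length = UHSParam.m d a₀ x.length := by
  rw [uFn_apply, length_boolPair, length_boolPair]
  simp only [ones, List.length_replicate, UHSParam.m]

/-- `uFn d a₀ ∈ FP`. [folklore] -/
theorem uFn_mem_FP : uFn d a₀ ∈ FP :=
  fanoutFn_mem_FP (kFn_mem_FP d a₀) (fanoutFn_mem_FP (EFn_mem_FP d) (IFn_mem_FP d))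

/-- **The first stage** `FFn d a₀ x = ⟨u(|x|), x⟩`: the parameter word next to the input, ready for
the exponential pad to act on the first component. [Arora–Barak 2009, §2.6.2 (padding)] [folklore] -/
noncomputable def FFn : List Bool → List Bool :=
  fanoutFn (uFn d a₀) id

/-- Value of `FFn`. [folklore] -/
theorem FFn_apply (x : List Bool) : FFn d a₀ x = boolPair (uFn d a₀ x) x := by
  simp [FFn]

/-- `FFn d a₀ ∈ FP`. [folklore] -/
theorem FFn_mem_FP : FFn d a₀ ∈ FP :=
  fanoutFn_mem_FP (uFn_mem_FP d a₀) OracleCompose.id_mem_FP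

end UHSPad

end Literature.Computability.MetaComplexity
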